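import Mathlib.Algebra.Homology.HomotopyCategory.MappingCone
import Mathlib.Algebra.Homology.Embedding.CochainComplex
import HarnessLib

/-!
# Attaching a cell below a cochain complex: the mapping cone of a morphism from a single complex

Layer `Literature/Algebra/Homology` (generic homological algebra over an abelian category; 0 named facts, no instances, no notation).
For a cochain complex `Q`, a degree `a`, an object `E` and a morphism `ψ₀ : E → Qᵃ` with `ψ₀ ≫ dᵃ = 0`, the **attached complex**
`Q⟨ψ₀⟩ := Cone(E[-a] ⟶ Q)` (Mathlib `CochainComplex.mappingCone` of `HomologicalComplex.mkHomFromSingle ψ₀`; Weibel §1.5) is `Q` with `E`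
glued in degree `a − 1` along `ψ₀` — the elementary step of building a resolution «one syzygy at a time» (Fulton B.8.3, Hartshorne III Ex. 6.9):

* terms: `inr : Qᵖ → Q⟨ψ₀⟩ᵖ` is an isomorphism for `p + 1 ≠ a` (`isIso_inr_f`, generally `isIso_inr_f_of_isZero`, `isIso_snd_v_of_isZero`)
  and `Q⟨ψ₀⟩ᵃ⁻¹ ≅ E ⊞ Qᵃ⁻¹` (`ιE`, `isIso_ιE` when `Qᵃ⁻¹ = 0`, `isIso_inl_v_of_isZero`); the differential on `E` is `ψ₀` (`ιE_d`), and
  `Q⟨ψ₀⟩ᵃ → Q⟨ψ₀⟩ᵃ⁺¹` is `Qᵃ → Qᵃ⁺¹` (`d_attach_eq`); support (`isZero_attach_X`, `isStrictlyLE_attach`, `isStrictlyLE_mappingCone`);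
* maps out: a chain map `β : Q ⟶ K` with `(E[-a] → Q) ≫ β = 0` extends to `Q⟨ψ₀⟩ ⟶ K` (`descOfCompEqZero`, Mathlib `mappingCone.desc` with zero
  first component; `fromSingle_comp_eq_zero`, `fromSingle_comp_eq_zero_of_comp`);
* homology: `inr` is a quasi-isomorphism in every degree `i` with `i, i + 1 ≠ a` (`quasiIsoAt_inr_of_isZero`), so exactness and `QuasiIsoAt β` are
  unchanged there (`exactAt_attach_iff`, `quasiIsoAt_descOfCompEqZero_iff`); and **if `E ↠ ker g` for a morphism `g : Qᵃ → D` killing `dᵃ⁻¹`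
  and `ψ₀`, then `Q⟨ψ₀⟩ᵃ⁻¹ → Q⟨ψ₀⟩ᵃ → D` is exact** (`exact_attach`; `exactAt_attach` for `g = dᵃ`) — the comparison with the model
  `E ⊞ Qᵃ⁻¹ → Qᵃ → D` is an epi–iso–mono morphism of short complexes (Mathlib `ShortComplex.exact_iff_of_epi_of_isIso_of_mono`);
* bookkeeping: `Epi (kernel.lift g u _)` under composition with monomorphisms ∕ isomorphisms ∕ `biprod.desc` (`epi_kernelLift_comp_mono`,
  `epi_kernelLift_iso_comp`, `epi_kernelLift_desc`, `epi_kernelLift_of_comp_mono`, `epi_kernelLift_of_iso_comp`, `epi_kernelLift_d_of_exactAt`),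
  and the degree-`m` criterion `quasiIsoAt_toSingle_iff` for `P ⟶ A[-m]` with `Pᵐ⁺¹ = 0` (the tree's `CochainComplex.quasiIsoAt_zero_toSingle_iff`
  in any degree).

Used by `AlgebraicGeometry/KTheory/AdaptedResolution` (vector-bundle resolutions dominating a given complex). Mathlib searched (pin):
`CochainComplex.mappingCone` (`inl`, `inr`, `fst`, `snd`, `desc`, `inl_v_d`, `d_snd_v`, `id_X`, `isZero_X_iff`, `ext_from`),
`ShortComplex.quasiIso_of_epi_of_isIso_of_mono`, `exact_iff_epi_kernel_lift`, `quasiIso_iff_of_zeros'`, `quasiIsoAt_iff_comp_left`, `kernelCompMono`,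
`kernelIsIsoComp` (used). Research route conditional on HC_CM; not a corollary; nothing here refers to it.

## References

* C. A. Weibel, *An introduction to homological algebra* (1994), §1.5 (mapping cones and cylinders), 1.2–1.3 (exactness, kernels), Exercise 2.2.3. [Weibel1994]
* W. Fulton, *Intersection Theory*, 2nd ed. (1998), App. B.8.3 (iii)–(v). [Fulton1998]
* The Stacks Project, Tag 014D–014I (cones of maps of complexes). [StacksProject]
-/

noncomputable section

open CategoryTheory CategoryTheory.Limits ZeroObject HomologicalComplex
open CochainComplex CochainComplex.HomComplex

namespace Literature.Algebra.Homology.AttachCell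


/-! ### §0 Attaching one object below a cochain complex: the mapping cone of a morphism from a single complex -/


variable {C : Type*} [Category C] [Abelian C]

section Inr

variable {F G : CochainComplex C ℤ} (φ : F ⟶ G)

/-- In a degree `p` where `Fᵖ⁺¹ = 0`, the inclusion `inr : Gᵖ → Cone(φ)ᵖ` is an isomorphism with inverse `snd`. [cite: Weibel1994, §1.5 (mapping cones) and 1.2–1.3 (exactness, kernels)] -/
theorem isIso_inr_f_of_isZero (p : ℤ) (h : IsZero (F.X (p + 1))) : IsIso ((mappingCone.inr φ).f p) := by
  refine ⟨(mappingCone.snd φ).v p p (add_zero p), by simp, ?_⟩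
  apply mappingCone.ext_from φ (p + 1) p rfl
  · rw [mappingCone.inl_v_snd_v_assoc, zero_comp, Category.comp_id]
    exact h.eq_of_src _ _
  · rw [mappingCone.inr_f_snd_v_assoc, Category.comp_id]

/-- `inr : Gᵖ → Cone(φ)ᵖ` is a (split) monomorphism in every degree. [cite: Weibel1994, §1.5 (mapping cones) and 1.2–1.3 (exactness, kernels)] -/
theorem mono_inr_f (p : ℤ) : Mono ((mappingCone.inr φ).f p) :=
  mono_of_mono_fac (mappingCone.inr_f_snd_v φ p)

/-- `inr : G ⟶ Cone(φ)` is a quasi-isomorphism in every degree `i` with `Fⁱ = Fⁱ⁺¹ = 0`. [cite: Weibel1994, §1.5 (mapping cones) and 1.2–1.3 (exactness, kernels)] -/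
theorem quasiIsoAt_inr_of_isZero (i : ℤ) (h₀ : IsZero (F.X i)) (h₁ : IsZero (F.X (i + 1))) :
    QuasiIsoAt (mappingCone.inr φ) i := by
  rw [quasiIsoAt_iff' (mappingCone.inr φ) (i - 1) i (i + 1) (by simp) (by simp)]
  haveI : IsIso ((mappingCone.inr φ).f (i - 1)) := isIso_inr_f_of_isZero φ (i - 1) (by rwa [sub_add_cancel])
  haveI : IsIso ((mappingCone.inr φ).f i) := isIso_inr_f_of_isZero φ i h₁
  haveI : Mono ((mappingCone.inr φ).f (i + 1)) := mono_inr_f φ (i + 1)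
  haveI : Epi ((shortComplexFunctor' C (ComplexShape.up ℤ) (i - 1) i (i + 1)).map (mappingCone.inr φ)).τ₁ := by
    change Epi ((mappingCone.inr φ).f (i - 1)); infer_instance
  haveI : IsIso ((shortComplexFunctor' C (ComplexShape.up ℤ) (i - 1) i (i + 1)).map (mappingCone.inr φ)).τ₂ := by
    change IsIso ((mappingCone.inr φ).f i); infer_instance
  haveI : Mono ((shortComplexFunctor' C (ComplexShape.up ℤ) (i - 1) i (i + 1)).map (mappingCone.inr φ)).τ₃ := by
    change Mono ((mappingCone.inr φ).f (i + 1)); infer_instance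
  exact ShortComplex.quasiIso_of_epi_of_isIso_of_mono _

/-- The cone of `φ : F ⟶ G` is strictly `≤ n` when `G` is and `F` is strictly `≤ n + 1`. [cite: Weibel1994, §1.5 (mapping cones) and 1.2–1.3 (exactness, kernels)] -/
theorem isStrictlyLE_mappingCone (n : ℤ) [F.IsStrictlyLE (n + 1)] [G.IsStrictlyLE n] : (mappingCone φ).IsStrictlyLE n := by
  rw [isStrictlyLE_iff]
  intro i hi
  rw [mappingCone.isZero_X_iff]
  exact ⟨F.isZero_of_isStrictlyLE (n + 1) (i + 1) (by omega), G.isZero_of_isStrictlyLE n i hi⟩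

/-- A morphism out of the cone vanishing on `F`: `desc` with zero first component, for `β : G ⟶ K` with `φ ≫ β = 0`. [cite: Weibel1994, §1.5 (mapping cones) and 1.2–1.3 (exactness, kernels)] -/
def descOfCompEqZero {K : CochainComplex C ℤ} (β : G ⟶ K) (hβ : φ ≫ β = 0) : mappingCone φ ⟶ K :=
  mappingCone.desc φ 0 β (by rw [δ_zero, hβ, Cochain.ofHom_zero])

/-- `inr ≫ desc = β`. [cite: Weibel1994, §1.5 (mapping cones)] -/
@[reassoc (attr := simp)]
theorem inr_descOfCompEqZero {K : CochainComplex C ℤ} (β : G ⟶ K) (hβ : φ ≫ β = 0) :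
    mappingCone.inr φ ≫ descOfCompEqZero φ β hβ = β :=
  mappingCone.inr_desc φ _ _ _

/-- In degree `p`, the extension is `snd ≫ βᵖ`. [cite: Weibel1994, §1.5 (mapping cones)] -/
theorem descOfCompEqZero_f {K : CochainComplex C ℤ} (β : G ⟶ K) (hβ : φ ≫ β = 0) (p : ℤ) :
    (descOfCompEqZero φ β hβ).f p = (mappingCone.snd φ).v p p (add_zero p) ≫ β.f p := by
  rw [descOfCompEqZero, mappingCone.desc_f φ _ _ _ p (p + 1) rfl, Cochain.zero_v, comp_zero, zero_add]

end Inr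

section Kernel

variable {A B D D' : C}

/-- `Epi (kernel.lift g u _)` is unchanged by composing `g` with a monomorphism. [cite: Weibel1994, §1.5 (mapping cones) and 1.2–1.3 (exactness, kernels)] -/
theorem epi_kernelLift_comp_mono (g : B ⟶ D) (m : D ⟶ D') [Mono m] (u : A ⟶ B) (w : u ≫ g = 0)
    [Epi (kernel.lift g u w)] : Epi (kernel.lift (g ≫ m) u (by rw [reassoc_of% w, zero_comp])) := by
  have h : kernel.lift (g ≫ m) u (by rw [reassoc_of% w, zero_comp]) = kernel.lift g u w ≫ (kernelCompMono g m).inv := by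
    apply equalizer.hom_ext
    simp
  rw [h]
  infer_instance

/-- `Epi (kernel.lift g u _)` transported along an isomorphism of the middle object. [cite: Weibel1994, §1.5 (mapping cones) and 1.2–1.3 (exactness, kernels)] -/
theorem epi_kernelLift_iso_comp {B' : C} (e : B' ⟶ B) [IsIso e] (g : B ⟶ D) (u : A ⟶ B') (w : (u ≫ e) ≫ g = 0)
    [Epi (kernel.lift g (u ≫ e) w)] : Epi (kernel.lift (e ≫ g) u (by rw [← Category.assoc, w])) := by
  have h : kernel.lift (e ≫ g) u (by rw [← Category.assoc, w]) = kernel.lift g (u ≫ e) w ≫ (kernelIsIsoComp e g).inv := by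
    apply equalizer.hom_ext
    simp
  rw [h]
  infer_instance

/-- If `A ⊞ B' → B` is `(u, v)` with `Epi (kernel.lift g u _)`, then `Epi (kernel.lift g (desc u v) _)`. [cite: Weibel1994, §1.5 (mapping cones) and 1.2–1.3 (exactness, kernels)] -/
theorem epi_kernelLift_desc {B' : C} (g : B ⟶ D) (u : A ⟶ B) (v : B' ⟶ B) (wu : u ≫ g = 0) (wv : v ≫ g = 0)
    [Epi (kernel.lift g u wu)] : Epi (kernel.lift g (biprod.desc u v) (by ext <;> simp [wu, wv])) := by
  have h : biprod.inl ≫ kernel.lift g (biprod.desc u v) (by ext <;> simp [wu, wv]) = kernel.lift g u wu := by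
    apply equalizer.hom_ext
    simp
  exact epi_of_epi_fac h

end Kernel

section Single

variable {Q : CochainComplex C ℤ} {a : ℤ} {E : C} (ψ₀ : E ⟶ Q.X a) (hψ : ψ₀ ≫ Q.d a (a + 1) = 0)

/-- The chain map `E[-a] ⟶ Q` given by `ψ₀ : E → Qᵃ` with `ψ₀ ≫ dᵃ = 0`. [cite: Weibel1994, §1.5 (mapping cones) and 1.2–1.3 (exactness, kernels)] -/
def fromSingle : (single C (ComplexShape.up ℤ) a).obj E ⟶ Q :=
  mkHomFromSingle ψ₀ (fun k (hk : a + 1 = k) => by subst hk; exact hψ)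

/-- In degree `a`, `E[-a] ⟶ Q` is `ψ₀` after the identification `(E[-a])ᵃ ≅ E`. [cite: Weibel1994, §1.5 (mapping cones)] -/
theorem fromSingle_f : (fromSingle ψ₀ hψ).f a = (singleObjXSelf (ComplexShape.up ℤ) a E).hom ≫ ψ₀ :=
  mkHomFromSingle_f ψ₀ _

/-- **The attached complex** `Q⟨ψ₀⟩ := Cone(E[-a] ⟶ Q)`: `E` attached in degree `a - 1` below `Q`, with differential `ψ₀ : E → Qᵃ`. [cite: Weibel1994, §1.5 (mapping cones) and 1.2–1.3 (exactness, kernels)] -/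
abbrev attach : CochainComplex C ℤ := mappingCone (fromSingle ψ₀ hψ)

/-- The single complex `E[-a]` vanishes off degree `a`. [cite: Weibel1994, §1.5 (mapping cones) and 1.2–1.3 (exactness, kernels)] -/
theorem isZero_single_X (i : ℤ) (hi : i ≠ a) : IsZero (((single C (ComplexShape.up ℤ) a).obj E).X i) :=
  isZero_single_obj_X _ _ _ _ hi

/-- In degrees `p` with `p + 1 ≠ a` the terms of `Q⟨ψ₀⟩` are those of `Q` (`inr` is an isomorphism there). [cite: Weibel1994, §1.5 (mapping cones) and 1.2–1.3 (exactness, kernels)] -/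
theorem isIso_inr_f (p : ℤ) (hp : p + 1 ≠ a) : IsIso ((mappingCone.inr (fromSingle ψ₀ hψ)).f p) :=
  isIso_inr_f_of_isZero _ p (isZero_single_X (C := C) (a := a) (E := E) (p + 1) hp)

end Single

section Exact

variable {Q : CochainComplex C ℤ} {a : ℤ} {E : C} (ψ₀ : E ⟶ Q.X a) (hψ : ψ₀ ≫ Q.d a (a + 1) = 0) {c : ℤ} (hca : c + 1 = a)

include hca in
/-- For `g : Qᵃ → D` killing `dᵃ⁻¹` and `ψ₀`: the composite `Q⟨ψ₀⟩ᵃ⁻¹ → Q⟨ψ₀⟩ᵃ ≅ Qᵃ → D` vanishes. [cite: Weibel1994, §1.5 (mapping cones) and 1.2–1.3 (exactness, kernels)] -/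
theorem d_snd_comp_eq_zero {D : C} (g : Q.X a ⟶ D) (hdg : Q.d c a ≫ g = 0) (hψg : ψ₀ ≫ g = 0) :
    (attach ψ₀ hψ).d c a ≫ (mappingCone.snd (fromSingle ψ₀ hψ)).v a a (add_zero a) ≫ g = 0 := by
  rw [mappingCone.d_snd_v_assoc _ c a hca, Preadditive.add_comp, Category.assoc, Category.assoc, hdg,
    comp_zero, add_zero, fromSingle_f, Category.assoc, hψg, comp_zero, comp_zero]

include hca in
/-- **Exactness after attaching**: if `E → ker g` is an epimorphism (for `g : Qᵃ → D` killing `dᵃ⁻¹` and `ψ₀`), then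
`Q⟨ψ₀⟩ᵃ⁻¹ → Q⟨ψ₀⟩ᵃ → D` is exact — `Q⟨ψ₀⟩ᵃ⁻¹ ≅ E ⊞ Qᵃ⁻¹` maps by `(ψ₀, dᵃ⁻¹)`. [cite: Weibel1994, §1.5 (mapping cones) and 1.2–1.3 (exactness, kernels)] -/
theorem exact_attach {D : C} (g : Q.X a ⟶ D) (hdg : Q.d c a ≫ g = 0) (hψg : ψ₀ ≫ g = 0)
    [Epi (kernel.lift g ψ₀ hψg)] {g' : (attach ψ₀ hψ).X a ⟶ D}
    (hg' : g' = (mappingCone.snd (fromSingle ψ₀ hψ)).v a a (add_zero a) ≫ g) (w : (attach ψ₀ hψ).d c a ≫ g' = 0) :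
    (ShortComplex.mk _ g' w).Exact := by
  subst hg'
  -- the model short complex `E ⊞ Qᵃ⁻¹ → Qᵃ → D`
  have wS : biprod.desc ψ₀ (Q.d c a) ≫ g = 0 := by ext <;> simp [hdg, hψg]
  have hS₁ : (ShortComplex.mk (biprod.desc ψ₀ (Q.d c a)) g wS).Exact := by
    rw [ShortComplex.exact_iff_epi_kernel_lift]
    exact epi_kernelLift_desc g ψ₀ (Q.d c a) hψg hdg
  let e := singleObjXSelf (ComplexShape.up ℤ) a E
  let φ := fromSingle ψ₀ hψ
  let τ₁ : E ⊞ Q.X c ⟶ (attach ψ₀ hψ).X c :=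
    biprod.desc (e.inv ≫ (mappingCone.inl φ).v a c (by omega)) ((mappingCone.inr φ).f c)
  have hFd : ((single C (ComplexShape.up ℤ) a).obj E).d a (a + 1) = 0 := by simp
  have comm₁₂ : τ₁ ≫ (attach ψ₀ hψ).d c a = biprod.desc ψ₀ (Q.d c a) ≫ (mappingCone.inr φ).f a := by
    apply biprod.hom_ext'
    · rw [biprod.inl_desc_assoc, biprod.inl_desc_assoc, Category.assoc,
        mappingCone.inl_v_d φ a c (a + 1) (by omega) (by omega), hFd, zero_comp, sub_zero,
        show φ.f a = e.hom ≫ ψ₀ from fromSingle_f ψ₀ hψ, Category.assoc, e.inv_hom_id_assoc]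
    · rw [biprod.inr_desc_assoc, biprod.inr_desc_assoc, mappingCone.inr_f_d]
  have comm₂₃ : (mappingCone.inr φ).f a ≫ ((mappingCone.snd φ).v a a (add_zero a) ≫ g) = g ≫ 𝟙 D := by
    rw [mappingCone.inr_f_snd_v_assoc, Category.comp_id]
  -- `τ₁` is a split epimorphism (`id_X`)
  haveI : Epi τ₁ := by
    refine epi_of_epi_fac (f := biprod.lift ((mappingCone.fst φ).1.v c a hca ≫ e.hom)
      ((mappingCone.snd φ).v c c (add_zero _))) (h := 𝟙 _) ?_
    rw [biprod.lift_desc, Category.assoc, e.hom_inv_id_assoc]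
    exact mappingCone.id_X φ c a hca
  haveI : IsIso ((mappingCone.inr φ).f a) := isIso_inr_f ψ₀ hψ a (by omega)
  let τ : ShortComplex.mk (biprod.desc ψ₀ (Q.d c a)) g wS ⟶ ShortComplex.mk _ _ w :=
    ShortComplex.homMk τ₁ ((mappingCone.inr φ).f a) (𝟙 D) comm₁₂ comm₂₃
  haveI : Epi τ.τ₁ := by change Epi τ₁; infer_instance
  haveI : IsIso τ.τ₂ := by change IsIso ((mappingCone.inr φ).f a); infer_instance
  haveI : Mono τ.τ₃ := by change Mono (𝟙 D); infer_instance
  exact (ShortComplex.exact_iff_of_epi_of_isIso_of_mono τ).1 hS₁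

/-- The differential `Q⟨ψ₀⟩ᵃ → Q⟨ψ₀⟩ᵇ` (`a + 1 = b`) is `Qᵃ → Qᵇ` under the identifications `snd`/`inr`. [cite: Weibel1994, §1.5 (mapping cones) and 1.2–1.3 (exactness, kernels)] -/
theorem d_attach_eq {b : ℤ} (hab : a + 1 = b) : (attach ψ₀ hψ).d a b =
    (mappingCone.snd (fromSingle ψ₀ hψ)).v a a (add_zero a) ≫ Q.d a b ≫ (mappingCone.inr (fromSingle ψ₀ hψ)).f b := by
  apply mappingCone.ext_from _ b a hab
  · rw [mappingCone.inl_v_snd_v_assoc, zero_comp]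
    exact (isZero_single_X (C := C) (a := a) (E := E) b (by omega)).eq_of_src _ _
  · rw [mappingCone.inr_f_d, mappingCone.inr_f_snd_v_assoc]

include hca in
/-- **`Q⟨ψ₀⟩` is exact in degree `a` when `E ↠ ker(dᵃ : Qᵃ → Qᵇ)`** (`a + 1 = b`). [cite: Weibel1994, §1.5 (mapping cones) and 1.2–1.3 (exactness, kernels)] -/
theorem exactAt_attach {b : ℤ} (hab : a + 1 = b) (w : ψ₀ ≫ Q.d a b = 0) [Epi (kernel.lift (Q.d a b) ψ₀ w)] :
    (attach ψ₀ hψ).ExactAt a := by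
  rw [(attach ψ₀ hψ).exactAt_iff' c a b (by simp; omega) (by simp; omega)]
  haveI : Mono ((mappingCone.inr (fromSingle ψ₀ hψ)).f b) := mono_inr_f _ _
  haveI := epi_kernelLift_comp_mono (Q.d a b) ((mappingCone.inr (fromSingle ψ₀ hψ)).f b) ψ₀ w
  exact exact_attach ψ₀ hψ hca (Q.d a b ≫ (mappingCone.inr (fromSingle ψ₀ hψ)).f b)
    (by simp only [HomologicalComplex.d_comp_d_assoc, zero_comp]) _
    (by simpa only [Category.assoc] using d_attach_eq ψ₀ hψ hab) _

/-- Exactness of `Q⟨ψ₀⟩` in degrees `i` with `i + 1 ≠ a`, `i ≠ a` is that of `Q`. [cite: Weibel1994, §1.5 (mapping cones) and 1.2–1.3 (exactness, kernels)] -/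
theorem exactAt_attach_iff (i : ℤ) (h₁ : i + 1 ≠ a) (h₂ : i ≠ a) : (attach ψ₀ hψ).ExactAt i ↔ Q.ExactAt i := by
  haveI : QuasiIsoAt (mappingCone.inr (fromSingle ψ₀ hψ)) i :=
    quasiIsoAt_inr_of_isZero _ i (isZero_single_X (C := C) (a := a) (E := E) i h₂)
      (isZero_single_X (C := C) (a := a) (E := E) (i + 1) h₁)
  exact (exactAt_iff_of_quasiIsoAt (mappingCone.inr (fromSingle ψ₀ hψ)) i).symm

end Exact

section More

variable {F G : CochainComplex C ℤ} (φ : F ⟶ G)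

/-- In a degree `q` where `G^q = 0`, `inl : Fᵖ → Cone(φ)^q` (`p = q + 1`) is an isomorphism with inverse `fst`. [cite: Weibel1994, §1.5 (mapping cones) and 1.2–1.3 (exactness, kernels)] -/
theorem isIso_inl_v_of_isZero (p q : ℤ) (hpq : p + (-1) = q) (h : IsZero (G.X q)) : IsIso ((mappingCone.inl φ).v p q hpq) := by
  refine ⟨(mappingCone.fst φ).1.v q p (by omega), by simp, ?_⟩
  have hid := mappingCone.id_X φ q p (by omega)
  rw [h.eq_of_tgt ((mappingCone.snd φ).v q q (add_zero q)) 0, zero_comp, add_zero] at hid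
  exact hid

/-- `snd : Cone(φ)ᵖ → Gᵖ` is an isomorphism where `Fᵖ⁺¹ = 0` (it is inverse to `inr`). [cite: Weibel1994, §1.5 (mapping cones) and 1.2–1.3 (exactness, kernels)] -/
theorem isIso_snd_v_of_isZero (p : ℤ) (h : IsZero (F.X (p + 1))) : IsIso ((mappingCone.snd φ).v p p (add_zero p)) := by
  haveI := isIso_inr_f_of_isZero φ p h
  have : (mappingCone.snd φ).v p p (add_zero p) = inv ((mappingCone.inr φ).f p) :=
    IsIso.eq_inv_of_hom_inv_id (mappingCone.inr_f_snd_v φ p)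
  rw [this]
  infer_instance

/-- `QuasiIsoAt` transfers from `β` to its extension `Cone(φ) ⟶ K` in every degree `i` with `Fⁱ = Fⁱ⁺¹ = 0`. [cite: Weibel1994, §1.5 (mapping cones) and 1.2–1.3 (exactness, kernels)] -/
theorem quasiIsoAt_descOfCompEqZero_iff {K : CochainComplex C ℤ} (β : G ⟶ K) (hβ : φ ≫ β = 0) (i : ℤ)
    (h₀ : IsZero (F.X i)) (h₁ : IsZero (F.X (i + 1))) : QuasiIsoAt (descOfCompEqZero φ β hβ) i ↔ QuasiIsoAt β i := by
  haveI := quasiIsoAt_inr_of_isZero φ i h₀ h₁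
  rw [← quasiIsoAt_iff_comp_left (mappingCone.inr φ) (descOfCompEqZero φ β hβ) i, inr_descOfCompEqZero]

end More

section KernelTransport

variable {A B D : C}

/-- `Epi (kernel.lift g u _)` for `g' = g ≫ m`, `m` mono. [cite: Weibel1994, §1.5 (mapping cones) and 1.2–1.3 (exactness, kernels)] -/
theorem epi_kernelLift_of_comp_mono {g : B ⟶ D} {u : A ⟶ B} (w : u ≫ g = 0) [Epi (kernel.lift g u w)] {D' : C} (m : D ⟶ D')
    [Mono m] {g' : B ⟶ D'} (hg : g' = g ≫ m) : Epi (kernel.lift g' u (by rw [hg, reassoc_of% w, zero_comp])) := by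
  subst hg
  exact epi_kernelLift_comp_mono g m u w

/-- `Epi (kernel.lift g u _)` for `g' = e ≫ g`, `e` an isomorphism, `u' ≫ e = u`. [cite: Weibel1994, §1.5 (mapping cones) and 1.2–1.3 (exactness, kernels)] -/
theorem epi_kernelLift_of_iso_comp {g : B ⟶ D} {u : A ⟶ B} (w : u ≫ g = 0) [Epi (kernel.lift g u w)] {B' : C} (e : B' ⟶ B)
    [IsIso e] {u' : A ⟶ B'} (hu : u' ≫ e = u) {g' : B' ⟶ D} (hg : g' = e ≫ g) :
    Epi (kernel.lift g' u' (by rw [hg, ← Category.assoc, hu, w])) := by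
  subst hg hu
  exact epi_kernelLift_iso_comp e g u' w

/-- For a complex exact at `j`, `Kⁱ → ker(dʲ)` is an epimorphism (`i + 1 = j`, `j + 1 = k`). [cite: Weibel1994, §1.5 (mapping cones) and 1.2–1.3 (exactness, kernels)] -/
theorem epi_kernelLift_d_of_exactAt (K : CochainComplex C ℤ) (i j k : ℤ) (hij : i + 1 = j) (hjk : j + 1 = k) (h : K.ExactAt j) :
    Epi (kernel.lift (K.d j k) (K.d i j) (K.d_comp_d i j k)) :=
  ((K.exactAt_iff' i j k (by simp; omega) (by simp; omega)).1 h).epi_kernelLift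

end KernelTransport

section ToSingle

/-- **`QuasiIsoAt ε m` for `ε : P ⟶ A[-m]` with `Pᵐ⁺¹ = 0`** iff `Pᵐ⁻¹ → Pᵐ → A` is exact and `Pᵐ → A` is an epimorphism (the
tree's `CochainComplex.quasiIsoAt_zero_toSingle_iff`, in degree `m`). [cite: Weibel1994, §1.5 (mapping cones) and 1.2–1.3 (exactness, kernels)] -/
theorem quasiIsoAt_toSingle_iff (P : CochainComplex C ℤ) (m : ℤ) (h₁ : IsZero (P.X (m + 1))) (A : C)
    (ε : P ⟶ (single C (ComplexShape.up ℤ) m).obj A) :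
    QuasiIsoAt ε m ↔
      (ShortComplex.mk (P.d (m - 1) m) (ε.f m ≫ (singleObjXSelf (ComplexShape.up ℤ) m A).hom)
          (by rw [← Category.assoc, ← ε.comm, single_obj_d, comp_zero, zero_comp])).Exact ∧
        Epi (ε.f m ≫ (singleObjXSelf (ComplexShape.up ℤ) m A).hom) := by
  have hcomm : P.d (m - 1) m ≫ ε.f m = 0 := by rw [← ε.comm, single_obj_d, comp_zero]
  have key : QuasiIsoAt ε m ↔ (ShortComplex.mk (P.d (m - 1) m) (ε.f m) hcomm).Exact ∧ Epi (ε.f m) := by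
    rw [quasiIsoAt_iff' ε (m - 1) m (m + 1) (by simp) (by simp)]
    exact ShortComplex.quasiIso_iff_of_zeros' _ (h₁.eq_of_tgt _ _) rfl rfl
  rw [key]
  let e := singleObjXSelf (ComplexShape.up ℤ) m A
  let i : ShortComplex.mk (P.d (m - 1) m) (ε.f m) hcomm ≅
      ShortComplex.mk (P.d (m - 1) m) (ε.f m ≫ e.hom) (by rw [← Category.assoc, hcomm, zero_comp]) :=
    ShortComplex.isoMk (Iso.refl _) (Iso.refl _) e (by simp) (by simp)
  constructor
  · rintro ⟨hex, hepi⟩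
    exact ⟨(ShortComplex.exact_iff_of_iso i).1 hex, epi_comp _ _⟩
  · rintro ⟨hex, hepi⟩
    refine ⟨(ShortComplex.exact_iff_of_iso i).2 hex, ?_⟩
    have : Epi ((ε.f m ≫ e.hom) ≫ e.inv) := epi_comp _ _
    simpa using this

end ToSingle

section SingleMore

variable {Q : CochainComplex C ℤ} {a : ℤ} {E : C} (ψ₀ : E ⟶ Q.X a) (hψ : ψ₀ ≫ Q.d a (a + 1) = 0)

/-- The inclusion `ιE : E → Q⟨ψ₀⟩ᶜ` of the attached object (`c + 1 = a`). [cite: Weibel1994, §1.5 (mapping cones) and 1.2–1.3 (exactness, kernels)] -/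
def ιE (c : ℤ) (hca : c + 1 = a) : E ⟶ (attach ψ₀ hψ).X c :=
  (singleObjXSelf (ComplexShape.up ℤ) a E).inv ≫ (mappingCone.inl (fromSingle ψ₀ hψ)).v a c (by omega)

/-- `ιE ≫ d = ψ₀ ≫ inr`: the differential of `Q⟨ψ₀⟩` on the attached object is `ψ₀`. [cite: Weibel1994, §1.5 (mapping cones) and 1.2–1.3 (exactness, kernels)] -/
@[reassoc]
theorem ιE_d (c : ℤ) (hca : c + 1 = a) :
    ιE ψ₀ hψ c hca ≫ (attach ψ₀ hψ).d c a = ψ₀ ≫ (mappingCone.inr (fromSingle ψ₀ hψ)).f a := by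
  have hFd : ((single C (ComplexShape.up ℤ) a).obj E).d a (a + 1) = 0 := by simp
  rw [ιE, Category.assoc, mappingCone.inl_v_d (fromSingle ψ₀ hψ) a c (a + 1) (by omega) (by omega), hFd, zero_comp,
    sub_zero, fromSingle_f, Category.assoc, Iso.inv_hom_id_assoc]

/-- `ιE` is an isomorphism when `Qᶜ = 0`. [cite: Weibel1994, §1.5 (mapping cones) and 1.2–1.3 (exactness, kernels)] -/
theorem isIso_ιE (c : ℤ) (hca : c + 1 = a) (h : IsZero (Q.X c)) : IsIso (ιE ψ₀ hψ c hca) := by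
  haveI := isIso_inl_v_of_isZero (fromSingle ψ₀ hψ) a c (by omega) h
  unfold ιE
  infer_instance

/-- A morphism `E[-a] ⟶ H[-m]` with `a ≠ m` vanishes; so does `fromSingle ψ₀ hψ ≫ β` for `β : Q ⟶ H[-m]`. [cite: Weibel1994, §1.5 (mapping cones) and 1.2–1.3 (exactness, kernels)] -/
theorem fromSingle_comp_eq_zero {H : C} {m : ℤ} (β : Q ⟶ (single C (ComplexShape.up ℤ) m).obj H) (ham : a ≠ m) :
    fromSingle ψ₀ hψ ≫ β = 0 :=
  from_single_hom_ext ((isZero_single_obj_X (ComplexShape.up ℤ) m H a ham).eq_of_tgt _ _)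

/-- `fromSingle ψ₀ hψ ≫ β = 0` when `ψ₀ ≫ βᵃ = 0`. [cite: Weibel1994, §1.5 (mapping cones) and 1.2–1.3 (exactness, kernels)] -/
theorem fromSingle_comp_eq_zero_of_comp {K : CochainComplex C ℤ} (β : Q ⟶ K) (h : ψ₀ ≫ β.f a = 0) :
    fromSingle ψ₀ hψ ≫ β = 0 :=
  from_single_hom_ext (by rw [comp_f, fromSingle_f, Category.assoc, h, comp_zero, zero_f])

/-- The terms of `Q⟨ψ₀⟩` in degrees `i` with `i + 1 ≠ a` are zero when those of `Q` are. [cite: Weibel1994, §1.5 (mapping cones) and 1.2–1.3 (exactness, kernels)] -/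
theorem isZero_attach_X (i : ℤ) (hi : i + 1 ≠ a) (h : IsZero (Q.X i)) : IsZero ((attach ψ₀ hψ).X i) := by
  rw [mappingCone.isZero_X_iff]
  exact ⟨isZero_single_X (C := C) (a := a) (E := E) (i + 1) hi, h⟩

/-- `Q⟨ψ₀⟩` is strictly `≤ n` when `Q` is and `a ≤ n + 1`. [cite: Weibel1994, §1.5 (mapping cones) and 1.2–1.3 (exactness, kernels)] -/
theorem isStrictlyLE_attach (n : ℤ) (ha : a ≤ n + 1) [Q.IsStrictlyLE n] : (attach ψ₀ hψ).IsStrictlyLE n :=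
  haveI : CochainComplex.IsStrictlyLE ((single C (ComplexShape.up ℤ) a).obj E) (n + 1) :=
    CochainComplex.isStrictlyLE_of_le ((single C (ComplexShape.up ℤ) a).obj E) a (n + 1) ha
  isStrictlyLE_mappingCone _ n

end SingleMore


end Literature.Algebra.Homology.AttachCell

end
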